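import Literature.MathematicalPhysics.QuantumFieldTheory.Balaban1983to89.Node00.Record12Carriers
import Literature.MathematicalPhysics.QuantumFieldTheory.Balaban1983to89.Node00.CarriersB12Family

/-!
# NODE 00 (YM-PLAN Track A) — STAGE 3′(X.B12) COMPANION AT STAGE 12: THE (B4) DISPLAYS OF A [B12] LAYER AS ONE PROVISO RECORD (`B12Provisos`), THE KNIT FACES
# `b12LeafOfRecord₁₂_of_package` ∕ `B12FamLeafOfRecord₁₂` AT def-T's `Record12`, THE θ-EXPLICIT NAMED-λ₁₂ WORLD FACES, THE PROVISO-CARRYING SUCCESSOR RECORDS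
# `IsRecordOfRecord₁₂CB10YZWB8B12Prov` ∕ `…B8subB12Prov`, AND THE ERRATUM + KERNEL NEGATIVES FOR THE VACUOUS STAGE-11 CLOSER OF `Node00/CarriersB12Package` :219–:226

NODE 00 COMPANION MODULE, v1.1 AS A SUCCESSOR (seat `pub-ymgap-node00-def-B12` g2, 2026-08-26).  APPEND-ONLY: a NEW importing module — g32's `Node00/Record12Carriers` (C1, the Stage-12
pins and six-pin views) and this seat's `Node00/CarriersB12Package` (p456282) ∕ `Node00/CarriersB12Family` (p456876) are CONSUMED BY NAME; no landed file is touched.  WHY (three events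
of record): (1) def-T LOCATED-2 — `Record12.not_provisos₁₁` ∕ `not_isRecordOfRecord₁₁C`: the Stage-11 proviso predicate is EMPTY, so every `IsRecordOfRecord₁₁…` record predicate is
uninhabited and every Stage-11 record-level face is vacuous; director LINE №81 (3): the ₁₁ modules re-instantiate at def-T's `Record12` (p458710 ∕ p459432).  (2) dag-ref-C g18 READ117
card (B9) + dag-ref-G g2 ADDENDUM-ROW13 — the companion's record-level closer `b12_leaf_of_isRecordOfRecord₁₁CB10YZWB8B12_of_package` (p456282 :219–:226) is VACUOUS: its premise
type is empty ((1)), and its binder `hL : ∀ θ hP lam12, θ.Admissible → D = datumOfRecord₁₁ θ hP → ∀ P, B12Package (θ.Rz P.K) θ.s2.cB (lam12 P)` ranges over ALL residual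
layers, among them the zero layer `{lam12 P with B₃ := 0}` whose package field `hB : 1 ≤ B₃` reads `1 ≤ 0` — so at any stage whose proviso predicate IS inhabited such a binder is
UNSATISFIABLE (ref-C `probe-p457025-hL.lean`: `hL_false_of_record`).  (3) node00-def g32 INTENT-27: the Stage-12 `…_of_package` face is this seat's.

ERRATUM (p456282 `Node00/CarriersB12Package.lean` :219–:226, `b12_leaf_of_isRecordOfRecord₁₁CB10YZWB8B12_of_package`).  The declaration is kernel-true and VACUOUS for both reasons
above; it is LEFT IN PLACE as a settled edge (dag-n09-c's `Node00/CarriersB12FundamentalCase` :431 consumes it — equally vacuous) and is NOT re-keyed with its binder: §4 below proves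
`not_isRecordOfRecord₁₁CB10YZWB8B12` (its premise type is empty), `nonempty_forallPackageBinder₁₁` (its binder type is a FREE Π over the empty proviso type — inhabited outright),
the NAMED zero layer `ResidB12Run.zeroLayer` of ref-C READ #117 (`B₃ := 0, α₀ := 0`) with `isEmpty_package_zeroLayer` (no package) and `b12LeafOfRecord_zeroLayer` (a TRUE leaf all
the same — the junk horn), `not_forall_nonempty_package` (the package is NOT a law of the bare residual type), `not_forall_resid_package₁₂` and
`isEmpty_forallPackageBinder₁₂_of_isRecordOfRecord₁₂C` (the same binder TYPE is EMPTY at every Stage-12 record).  CONSEQUENTLY NO Stage-12 face of this module carries an ∀-over-layers package binder: the package is keyed on a NAMED layer `lam12` (§1, §2 —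
the :213 shape `b12LeafOfRecord₁₁_of_package` of the companion, re-instantiated) or carried as PROVISO FIELDS of a successor record predicate (§3 — ref-C READ116∕117 venue (i), g32's
`Record12CarriersB12` header «or as proviso fields of a successor record»).

WHAT IS DEFINED ∕ PROVED (kernel bookkeeping, 0 sorry).  §0 `B12Provisos Rz cB lam : Prop` — the THREE (B4) DISPLAYS of a [B12] layer of record as ONE proviso record: `package :
Nonempty (B12Package Rz cB lam)` (pp. 275–280 by reference, the companion's displayed package), `restrictions : Lemma4Restrictions lam.consts` («all the restrictions» HOLD at the
layer's constants — so the leaf `Lemma4Printed` is exercised, not vacuous), `zero_mem : 0 ∈ lam.A331` (p. 277 «At first let us take A = 0» — the class (3.31) is exercised); faces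
`B12Provisos.leaf`, `B12Provisos.lemma4_conclusion` ((3.53) membership for every `(𝐔, 𝐀, τ, B′)` of the printed domain AND the analyticity clause, OUTRIGHT), `B12Provisos.comp_zero_mem`
((3.53) at `𝐀 = 0`).  §1 Stage-12 faces over g32's `B12LeafOfRecord₁₂` ∕ `F12OfRecord₁₂`: `b12LeafOfRecord₁₂_of_package` (admissibility `hθ.pos.1 : 0 < O(1)LMB` + ONE named
package), `b12LeafOfRecord₁₂_of_provisos`; the family leaf `B12FamLeafOfRecord₁₂` over the stage-free family residual TYPE `ResidB12Fam₁₁` of p456876 (reused BY NAME — it reads no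
stage), `b12FamLeafOfRecord₁₂_iff`, `b12FamLeafOfRecord₁₂_toStage11 : Iff.rfl`, `b12FamLeafOfRecord₁₂_of_packages`, `b12LeafOfRecord₁₂_of_b12FamLeafOfRecord₁₂`.  §2 θ-EXPLICIT
NAMED-λ₁₂ WORLD FACES (no record predicate; the presenting slots are arguments): `b12_leaf_of_up_view₁₂B12B8B10YZW_of_leaf ∕ _of_package ∕ _of_provisos` and the same over the
six-pin view with [B8′] `view₁₂B12B8subB10YZW` — `(leavesP w P).b12` at a world presenting the six-pin S-binding of a NAMED `(θ, lam12, …)`, from the leaf ∕ a package ∕ the provisos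
AT THAT layer (g32's `upOfRecord₅CS_view₁₂B12B8(sub)B10YZW_leaves` `.1`).  §3 PROVISO-CARRYING SUCCESSOR RECORDS: `IsRecordOfRecord₁₂CB10YZWB8B12Prov D w` = g32's C3
`IsRecordOfRecord₁₂CB10YZWB8B12` clauses VERBATIM (θ, `Provisos₁₂`, the six residual slots, admissibility, `D = datumOfRecord₁₂ θ h`, `w.C`, window, `w.L`, `w.up = upOfRecord₅CS ∘
view₁₂B12B8B10YZW`) PLUS `∀ P, B12Provisos (θ.Rz P.K) θ.s2.cB (lam12 P)`; `exists_world_…` (inhabitation GIVEN `Provisos₁₂`, admissibility AND the provisos of the layer — honest: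
the package IS the content of pp. 275–280), `sixSlot_of_…` (forget the provisos: g32's six-slot ∃, same `D`, same `w` — the by-name map into C3's predicate is a one-line successor once
C3 lands), `leaf_b12_iff_of_…`, `b12_leaf_of_…` (UNCONDITIONAL at such a record: the node's conjunct 1 holds BECAUSE the record displays the package — GAP-STATED(package) by
construction, never a discharge), `…_rebind_of_isRecordOfRecord₁₂C` (a `₁₂C` record re-bound at named slots whose [B12] layer satisfies its provisos; the provisos are an INPUT);
twins `IsRecordOfRecord₁₂CB10YZWB8subB12Prov`, `exists_world_…`, `sixSlot_of_…`, `leaf_b12_iff_of_…`, `b12_leaf_of_…`, `…_rebind_of_isRecordOfRecord₁₂C` over the [B8′] view.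
§4 the erratum's kernel negatives (above) and the junk horn of (B4) by name: `b12LeafOfRecord_of_not_restrictions` (a layer violating the restrictions has a TRUE leaf, vacuously —
why a count line must display `restrictions`); §4 is DISPLAY ONLY — no face of §0–§3 consumes any of it (ref-C NOTE-2 (c)(iv)).

WHAT THIS IS NOT.  Not a discharge of N09 and not an estimate: `B12Package.inputs` ([15] (174)–(177), the gauge transformations (3.37)–(3.42), the identities and sizes of
pp. 275–280 for the residual letters `𝐊`, `𝐀₂`) stays a DISPLAYED HYPOTHESIS wherever it appears (as an argument in §1–§2, as the field `package` in §0∕§3); the third (B4) display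
«the letters of print» is NOT typed — [15]'s Landau-gauge functions have no tree object (lit-balaban-type-B12 LOCATED-CONFIRMED, 0 files) — so a layer with junk letters
(`𝐊 = 𝐀₂ = 0`) carrying a package says nothing about print's composite; SAID, not cured.  The `…Prov` records are inhabited ONLY given packages (`exists_world_…` takes them as
arguments); no unconditional inhabitation is claimed.  HONEST FRAMING: definitions + kernel bookkeeping; NO estimate; nothing of [Balaban1987RG1] ∕ [Balaban1985Variational]
asserted; N09 NOT discharged; counts unmoved (5∕28); one finite T⁴ programme at fixed ε, Bałaban as printed — NOT continuum ∕ ℝ⁴ ∕ infinite volume ∕ OS ∕ mass gap ∕ Clay.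
No `sorry`, no `axiom`, no `opaque`, no `instance`, no `notation`.  [Balaban1987RG1] = T. Bałaban, Commun. Math. Phys. **109** (1987) 249–301; [Balaban1985Variational] = Commun.
Math. Phys. **102** (1985) 277–309; [Balaban1989LargeFieldII] = Commun. Math. Phys. **122** (1989) 355–392. -/

noncomputable section

namespace Literature.MathematicalPhysics.QuantumFieldTheory.Balaban1983to89.Node00

open T4Continuum AveragingRT T4FiniteEpsInhabited FlowStep FlowStepRuns DagBinding T4DatumAssembly
open B12RegularSpaces111 (space space')
open B12RegularSpaces111SpecialUnitary (suModel)
open scoped Matrix.Norms.L2Operator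

/-! ## §0. The three (B4) displays of a [B12] layer of record as ONE proviso record -/

section Provisos

variable {P : Params} {N M : ℕ}

/-- **THE PROVISOS OF A [B12] LAYER OF RECORD** (the displays a count line at a record must carry, ref-C READ-115 (B4)): the companion's by-reference package (pp. 275–280) IS
AVAILABLE for the layer, «all the restrictions» of Lemma 4 HOLD at the layer's constants, and the zero field lies in the class (3.31) (p. 277 «At first let us take A = 0»).
A HYPOTHESIS record (`Prop`); nothing printed is asserted. [cite: Balaban1987RG1, Lemma 4 (3.53) p.280 with (3.26)–(3.52) pp.275–280; (3.31) p.276, p.277] -/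
structure B12Provisos (Rz : Sect2.Residual P (MatA N)) (cB : ℝ) (lam : ResidB12Run P N M) : Prop where
  package : Nonempty (B12Package Rz cB lam)
  restrictions : B12Sec2to5.Lemma4Restrictions lam.consts
  zero_mem : (0 : PBond P 0 → MatA N) ∈ lam.A331

namespace B12Provisos

variable [NeZero N] {Rz : Sect2.Residual P (MatA N)} {cB : ℝ} {lam : ResidB12Run P N M}

/-- The leaf of the layer from its provisos (the companion's knit face `b12LeafOfRecord_of_package` on the displayed package).  NOTE (ref-C READ116 (B4)): the leaf
`B12LeafOfRecord = Lemma4Printed …` is the typed IMPLICATION «restrictions → (3.53) ∧ analyticity»; the HONEST HORN — the conclusion with the restrictions DISPLAYED AND APPLIED — is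
`lemma4_conclusion` below (it uses the field `restrictions`); no face of this module reaches a leaf through the junk horn `b12LeafOfRecord_of_not_restrictions` (§4, display only).
[cite: Balaban1987RG1, Lemma 4 (3.53) p.280] -/
theorem leaf (h : B12Provisos Rz cB lam) (hcB : 0 < cB) : B12LeafOfRecord Rz cB lam :=
  h.package.elim fun L => b12LeafOfRecord_of_package Rz hcB lam L

/-- **THE CONCLUSION OF LEMMA 4 OUTRIGHT at a layer satisfying its provisos** — the leaf is NOT vacuous there: (3.53) for every `(𝐔, 𝐀, τ, B′)` of the printed domain, and the
analyticity clause. [cite: Balaban1987RG1, Lemma 4 (3.53) p.280] -/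
theorem lemma4_conclusion (h : B12Provisos Rz cB lam) (hcB : 0 < cB) :
    (∀ (U : (F12OfRecord Rz cB lam).CfgU) (A : (F12OfRecord Rz cB lam).CfgA) (τ : ℝ) (B' : (F12OfRecord Rz cB lam).CfgB),
        U ∈ (F12OfRecord Rz cB lam).Uprime ((1 + 2 * lam.consts.β) * lam.consts.α₀) ((1 + 2 * lam.consts.β) * lam.consts.α₁) →
          A ∈ (F12OfRecord Rz cB lam).A331 → 0 ≤ τ → τ ≤ 1 → (F12OfRecord Rz cB lam).normB B' < lam.consts.α₃ →
            (F12OfRecord Rz cB lam).comp U A τ B' ∈ (F12OfRecord Rz cB lam).Ucj lam.consts.α₀ lam.consts.α₁) ∧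
      (F12OfRecord Rz cB lam).analyticOn ((1 + 2 * lam.consts.β) * lam.consts.α₀) ((1 + 2 * lam.consts.β) * lam.consts.α₁) lam.consts.α₃ :=
  h.leaf hcB h.restrictions

/-- **(3.53) AT `𝐀 = 0`** (p. 277 «At first let us take A = 0»): the composite of every `𝐔` of the upper space, every `τ ∈ [0, 1]` and every small `B′` lies in `Uᶜ_j(X, α₀, α₁)`.
[cite: Balaban1987RG1, Lemma 4 (3.53) p.280, p.277] -/
theorem comp_zero_mem (h : B12Provisos Rz cB lam) (hcB : 0 < cB) (Φ : FieldPair P 0 (MatA N)ˣ (MatA N)) (τ : ℝ) (B' : PBond P 0 → MatA N)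
    (hΦ : Φ ∈ space (suModel N) (lam.frameBox Rz) (lam.csBox cB) ((1 + 2 * lam.consts.β) * lam.consts.α₀) ((1 + 2 * lam.consts.β) * lam.consts.α₁) lam.α₀)
    (hτ0 : 0 ≤ τ) (hτ1 : τ ≤ 1) (hB' : ‖B'‖ < lam.consts.α₃) :
    (F12OfRecord Rz cB lam).comp Φ (0 : PBond P 0 → MatA N) τ B' ∈ space' (suModel N) (lam.frameX Rz) (lam.csX cB) lam.consts.α₀ lam.consts.α₁ :=
  (h.lemma4_conclusion hcB).1 Φ (0 : PBond P 0 → MatA N) τ B' hΦ h.zero_mem hτ0 hτ1 hB'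

end B12Provisos

end Provisos

/-! ## §1. The knit faces AT def-T's STAGE 12 (`Record12`): one named package; the family leaf -/

section Stage12

variable (F : T4Family) (N : ℕ) [NeZero N]

/-- **THE KNIT FACE AT A STAGE-12 PARAMETER** (node00-def g32 INTENT-27 «`…_of_package` at ₁₂»): admissibility (`0 < O(1)LMB`) and the displayed package of THE NAMED layer `lam p` give
g32's Stage-12 leaf — the companion's `b12LeafOfRecord_of_package`. NOT a discharge: the package is a hypothesis. [cite: Balaban1987RG1, Lemma 4 (3.53) p.280] -/
theorem b12LeafOfRecord₁₂_of_package (θ : Stage12Params F N) (hθ : θ.Admissible F N) (lam : ResidB12 F N θ.τ9.M) (p : B12.RunParams)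
    (L : B12Package (θ.Rz p.K) θ.s2.cB (lam p)) : B12LeafOfRecord₁₂ F N θ lam p :=
  b12LeafOfRecord_of_package (θ.Rz p.K) hθ.pos.1 (lam p) L

/-- The same from the layer's provisos. [cite: Balaban1987RG1, Lemma 4 (3.53) p.280] -/
theorem b12LeafOfRecord₁₂_of_provisos (θ : Stage12Params F N) (hθ : θ.Admissible F N) (lam : ResidB12 F N θ.τ9.M) (p : B12.RunParams)
    (h : B12Provisos (θ.Rz p.K) θ.s2.cB (lam p)) : B12LeafOfRecord₁₂ F N θ lam p :=
  h.leaf hθ.pos.1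

/-- **THE FAMILY LEAF AT A STAGE-12 PARAMETER**, run `p` (11b's `θ.Rz p.K`, `O(1)LMB := θ.s2.cB`, cube size `θ.τ9.M`), over the stage-free family residual type `ResidB12Fam₁₁` of
`Node00/CarriersB12Family` (one `ResidB12Fam` per run; the type reads no stage). [cite: Balaban1987RG1, Lemma 4 (3.53) p.280] -/
def B12FamLeafOfRecord₁₂ (θ : Stage12Params F N) (lamF : ResidB12Fam₁₁ F N θ.τ9.M) (p : B12.RunParams) : Prop :=
  B12FamLeafOfRecord (θ.Rz p.K) θ.s2.cB (lamF p)

/-- … is g32's leaf at every instance `(k, j, □, X)` of the run. [cite: Balaban1987RG1, Lemma 4 (3.53) p.280 (bookkeeping)] -/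
theorem b12FamLeafOfRecord₁₂_iff (θ : Stage12Params F N) (lamF : ResidB12Fam₁₁ F N θ.τ9.M) (p : B12.RunParams) :
    B12FamLeafOfRecord₁₂ F N θ lamF p ↔ ∀ ι : IdxB12 (F.P p.K) θ.τ9.M, B12LeafOfRecord (θ.Rz p.K) θ.s2.cB ((lamF p).atIdx ι) :=
  b12FamLeafOfRecord_iff _ _ _

/-- The Stage-12 family leaf IS the Stage-11 one at every view `θ.toStage11 p′` (`Iff.rfl`: the view keeps `Rz`, `s2`, `τ9`). [cite: Balaban1987RG1, Lemma 4 (3.53) p.280 (bookkeeping)] -/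
theorem b12FamLeafOfRecord₁₂_toStage11 (θ : Stage12Params F N) (lamF : ResidB12Fam₁₁ F N θ.τ9.M) (p p' : B12.RunParams) :
    B12FamLeafOfRecord₁₁ F N (θ.toStage11 F N p') lamF p ↔ B12FamLeafOfRecord₁₂ F N θ lamF p :=
  Iff.rfl

/-- **KNIT FACE OF THE FAMILY LEAF at a Stage-12 parameter**: admissibility and a displayed package AT EVERY INSTANCE of the named family layer give the family leaf.
NOT a discharge. [cite: Balaban1987RG1, Lemma 4 (3.53) p.280] -/
theorem b12FamLeafOfRecord₁₂_of_packages (θ : Stage12Params F N) (hθ : θ.Admissible F N) (lamF : ResidB12Fam₁₁ F N θ.τ9.M) (p : B12.RunParams)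
    (L : ∀ ι : IdxB12 (F.P p.K) θ.τ9.M, B12Package (θ.Rz p.K) θ.s2.cB ((lamF p).atIdx ι)) : B12FamLeafOfRecord₁₂ F N θ lamF p :=
  b12FamLeafOfRecord_of_packages (θ.Rz p.K) hθ.pos.1 (lamF p) L

/-- The family leaf gives g32's Stage-12 leaf at the chosen instances (`ResidB12Fam₁₁.atIdx`). [cite: Balaban1987RG1, Lemma 4 (3.53) p.280 (bookkeeping)] -/
theorem b12LeafOfRecord₁₂_of_b12FamLeafOfRecord₁₂ (θ : Stage12Params F N) (lamF : ResidB12Fam₁₁ F N θ.τ9.M) (ι : ∀ p : B12.RunParams, IdxB12 (F.P p.K) θ.τ9.M)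
    (p : B12.RunParams) (h : B12FamLeafOfRecord₁₂ F N θ lamF p) : B12LeafOfRecord₁₂ F N θ (lamF.atIdx F N ι) p :=
  (b12FamLeafOfRecord₁₂_iff F N θ lamF p).1 h (ι p)

end Stage12

/-! ## §2. θ-explicit named-λ₁₂ world faces (the presenting slots are arguments; no record predicate) -/

section WorldFaces

variable (F : T4Family) (N : ℕ) [NeZero N]

/-- **`b12` AT A WORLD PRESENTING THE SIX-PIN S-BINDING OF A NAMED `(θ, lam12, lam, M⋆, ops, ζ, lamW)`**, from the leaf at that layer (g32's `upOfRecord₅CS_view₁₂B12B8B10YZW_leaves`).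
[cite: Balaban1987RG1, Lemma 4 (3.53) p.280 (the node's conjunct 1, bookkeeping)] -/
theorem b12_leaf_of_up_view₁₂B12B8B10YZW_of_leaf (θ : Stage12Params F N) (lam12 : ResidB12 F N θ.τ9.M) (lam : ResidB8 θ.toStage3Params) (Mstar : ℕ)
    (ops : OpsY N θ.toStage3Params Mstar) (ζ : ResidZ F N) (lamW : ResidW F N) {w : WorldP} {P : B12.RunParams}
    (hup : w.up P = upOfRecord₅CS F N (θ.view₁₂B12B8B10YZW F N lam12 lam Mstar ops ζ lamW) P) (hleaf : B12LeafOfRecord₁₂ F N θ lam12 P) :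
    (leavesP w P).b12 := by
  show (w.up P).b12
  rw [hup]
  exact (upOfRecord₅CS_view₁₂B12B8B10YZW_leaves F N θ lam12 lam Mstar ops ζ lamW P).1.2 hleaf

/-- … from admissibility and a displayed package AT THE NAMED layer (the honest re-key of the companion's :219 closer: ONE layer, not all). NOT a discharge.
[cite: Balaban1987RG1, Lemma 4 (3.53) p.280 (the node's conjunct 1, bookkeeping)] -/
theorem b12_leaf_of_up_view₁₂B12B8B10YZW_of_package (θ : Stage12Params F N) (hθ : θ.Admissible F N) (lam12 : ResidB12 F N θ.τ9.M) (lam : ResidB8 θ.toStage3Params)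
    (Mstar : ℕ) (ops : OpsY N θ.toStage3Params Mstar) (ζ : ResidZ F N) (lamW : ResidW F N) {w : WorldP} {P : B12.RunParams}
    (hup : w.up P = upOfRecord₅CS F N (θ.view₁₂B12B8B10YZW F N lam12 lam Mstar ops ζ lamW) P) (L : B12Package (θ.Rz P.K) θ.s2.cB (lam12 P)) :
    (leavesP w P).b12 :=
  b12_leaf_of_up_view₁₂B12B8B10YZW_of_leaf F N θ lam12 lam Mstar ops ζ lamW hup (b12LeafOfRecord₁₂_of_package F N θ hθ lam12 P L)

/-- … from admissibility and the provisos OF THE NAMED layer. NOT a discharge. [cite: Balaban1987RG1, Lemma 4 (3.53) p.280 (the node's conjunct 1, bookkeeping)] -/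
theorem b12_leaf_of_up_view₁₂B12B8B10YZW_of_provisos (θ : Stage12Params F N) (hθ : θ.Admissible F N) (lam12 : ResidB12 F N θ.τ9.M) (lam : ResidB8 θ.toStage3Params)
    (Mstar : ℕ) (ops : OpsY N θ.toStage3Params Mstar) (ζ : ResidZ F N) (lamW : ResidW F N) {w : WorldP} {P : B12.RunParams}
    (hup : w.up P = upOfRecord₅CS F N (θ.view₁₂B12B8B10YZW F N lam12 lam Mstar ops ζ lamW) P) (h : B12Provisos (θ.Rz P.K) θ.s2.cB (lam12 P)) :
    (leavesP w P).b12 :=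
  b12_leaf_of_up_view₁₂B12B8B10YZW_of_leaf F N θ lam12 lam Mstar ops ζ lamW hup (h.leaf hθ.pos.1)

/-- **`b12` AT A WORLD PRESENTING THE SIX-PIN S-BINDING WITH [B8′]** of a named `(θ, lam12, …)`, from the leaf (g32's `upOfRecord₅CS_view₁₂B12B8subB10YZW_leaves`).
[cite: Balaban1987RG1, Lemma 4 (3.53) p.280 (the node's conjunct 1, bookkeeping)] -/
theorem b12_leaf_of_up_view₁₂B12B8subB10YZW_of_leaf (θ : Stage12Params F N) (lam12 : ResidB12 F N θ.τ9.M) (lam : ResidB8 θ.toStage3Params) (Mstar : ℕ)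
    (ops : OpsY N θ.toStage3Params Mstar) (ζ : ResidZ F N) (lamW : ResidW F N) {w : WorldP} {P : B12.RunParams}
    (hup : w.up P = upOfRecord₅CS F N (θ.view₁₂B12B8subB10YZW F N lam12 lam Mstar ops ζ lamW) P) (hleaf : B12LeafOfRecord₁₂ F N θ lam12 P) :
    (leavesP w P).b12 := by
  show (w.up P).b12
  rw [hup]
  exact (upOfRecord₅CS_view₁₂B12B8subB10YZW_leaves F N θ lam12 lam Mstar ops ζ lamW P).1.2 hleaf

/-- … from admissibility and a displayed package at the named layer. NOT a discharge. [cite: Balaban1987RG1, Lemma 4 (3.53) p.280 (the node's conjunct 1, bookkeeping)] -/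
theorem b12_leaf_of_up_view₁₂B12B8subB10YZW_of_package (θ : Stage12Params F N) (hθ : θ.Admissible F N) (lam12 : ResidB12 F N θ.τ9.M) (lam : ResidB8 θ.toStage3Params)
    (Mstar : ℕ) (ops : OpsY N θ.toStage3Params Mstar) (ζ : ResidZ F N) (lamW : ResidW F N) {w : WorldP} {P : B12.RunParams}
    (hup : w.up P = upOfRecord₅CS F N (θ.view₁₂B12B8subB10YZW F N lam12 lam Mstar ops ζ lamW) P) (L : B12Package (θ.Rz P.K) θ.s2.cB (lam12 P)) :
    (leavesP w P).b12 :=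
  b12_leaf_of_up_view₁₂B12B8subB10YZW_of_leaf F N θ lam12 lam Mstar ops ζ lamW hup (b12LeafOfRecord₁₂_of_package F N θ hθ lam12 P L)

/-- … from admissibility and the provisos of the named layer. NOT a discharge. [cite: Balaban1987RG1, Lemma 4 (3.53) p.280 (the node's conjunct 1, bookkeeping)] -/
theorem b12_leaf_of_up_view₁₂B12B8subB10YZW_of_provisos (θ : Stage12Params F N) (hθ : θ.Admissible F N) (lam12 : ResidB12 F N θ.τ9.M) (lam : ResidB8 θ.toStage3Params)
    (Mstar : ℕ) (ops : OpsY N θ.toStage3Params Mstar) (ζ : ResidZ F N) (lamW : ResidW F N) {w : WorldP} {P : B12.RunParams}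
    (hup : w.up P = upOfRecord₅CS F N (θ.view₁₂B12B8subB10YZW F N lam12 lam Mstar ops ζ lamW) P) (h : B12Provisos (θ.Rz P.K) θ.s2.cB (lam12 P)) :
    (leavesP w P).b12 :=
  b12_leaf_of_up_view₁₂B12B8subB10YZW_of_leaf F N θ lam12 lam Mstar ops ζ lamW hup (h.leaf hθ.pos.1)

end WorldFaces

/-! ## §3. The proviso-carrying successor records (venue (i)): the six-pin records WITH the layer's provisos displayed -/

section ProvisoRecords

variable (F : T4Family) (N : ℕ) [NeZero N]

/-- **«(D, w) is the record, Stage 12, all SIX typed carrier groups pinned, `b8` surviving, AND the [B12] layer's provisos displayed»**: g32's `IsRecordOfRecord₁₂CB10YZWB8B12` clauses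
VERBATIM plus `∀ P, B12Provisos (θ.Rz P.K) θ.s2.cB (lam12 P)` — the by-reference package, the restrictions and `0 ∈ (3.31)` at every run's layer.  Inhabited only GIVEN packages
(`exists_world_…` below); the package is the content of pp. 275–280, displayed, never asserted. STATUS (ref-C NOTE-2 (c)(iii)): a PROVISO-CARRYING SUCCESSOR record — every closer over it is GAP-STATED(package) BY CONSTRUCTION and count-neutral, and it is NOT the world of record (N09's count line lives at def-T's `IsRecordOfRecord₁₂C`).
[cite: Balaban1987RG1, Lemma 4 (3.53) p.280 with (3.26)–(3.52) pp.275–280; Balaban1989LargeFieldII, Thm 1 + (0.1) pp.355–356 (objects of record)] -/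
def IsRecordOfRecord₁₂CB10YZWB8B12Prov (D : FiniteEpsData F (SU N)) (w : WorldP) : Prop :=
  ∃ (θ : Stage12Params F N) (h : θ.Provisos₁₂ F N) (lam12 : ResidB12 F N θ.τ9.M) (lam : ResidB8 θ.toStage3Params) (Mstar : ℕ) (ops : OpsY N θ.toStage3Params Mstar)
    (ζ : ResidZ F N) (lamW : ResidW F N),
    θ.Admissible F N ∧ D = datumOfRecord₁₂ F N θ h ∧ w.C = D.C ∧ (0 < w.γ ∧ w.γ ≤ θ.γ) ∧ w.L = (θ.L : ℝ) ∧
      (∀ P : B12.RunParams, w.up P = upOfRecord₅CS F N (θ.view₁₂B12B8B10YZW F N lam12 lam Mstar ops ζ lamW) P) ∧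
      ∀ P : B12.RunParams, B12Provisos (θ.Rz P.K) θ.s2.cB (lam12 P)

/-- Inhabitation GIVEN `Provisos₁₂`, admissibility and the provisos of the named layer (world built as in def-T's `exists_world_isRecordOfRecord₁₂C`). STATUS (ref-C NOTE-2 (c)(iii)): a PROVISO-CARRYING SUCCESSOR record — every closer over it is GAP-STATED(package) BY CONSTRUCTION and count-neutral, and it is NOT the world of record (N09's count line lives at def-T's `IsRecordOfRecord₁₂C`).
[cite: Balaban1989LargeFieldII, Thm 1 + (0.1) pp.355–356 (bookkeeping)] -/
theorem exists_world_isRecordOfRecord₁₂CB10YZWB8B12Prov (θ : Stage12Params F N) (h : θ.Provisos₁₂ F N) (hθ : θ.Admissible F N) (lam12 : ResidB12 F N θ.τ9.M)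
    (lam : ResidB8 θ.toStage3Params) (Mstar : ℕ) (ops : OpsY N θ.toStage3Params Mstar) (ζ : ResidZ F N) (lamW : ResidW F N)
    (hΛ : ∀ P : B12.RunParams, B12Provisos (θ.Rz P.K) θ.s2.cB (lam12 P)) {γw : ℝ} (hγw : 0 < γw ∧ γw ≤ θ.γ) :
    ∃ w : WorldP, IsRecordOfRecord₁₂CB10YZWB8B12Prov F N (datumOfRecord₁₂ F N θ h) w ∧ w.γ = γw := by
  obtain ⟨w₀, -, -⟩ := exists_world_isRecordOfRecord₁₂C F N θ h hθ hγw
  exact ⟨{ w₀ with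
      C := (datumOfRecord₁₂ F N θ h).C, γ := γw, L := (θ.L : ℝ), one_lt_L := by exact_mod_cast θ.hL.2,
      up := fun P => upOfRecord₅CS F N (θ.view₁₂B12B8B10YZW F N lam12 lam Mstar ops ζ lamW) P },
    ⟨θ, h, lam12, lam, Mstar, ops, ζ, lamW, hθ, rfl, rfl, hγw, rfl, fun _ => rfl, hΛ⟩, rfl⟩

variable {F N}
variable {D : FiniteEpsData F (SU N)} {w : WorldP}

/-- Forgetting the provisos: the six-slot presentation of g32's `IsRecordOfRecord₁₂CB10YZWB8B12` (its clauses verbatim), SAME datum, SAME world. STATUS (ref-C NOTE-2 (c)(iii)): a PROVISO-CARRYING SUCCESSOR record — every closer over it is GAP-STATED(package) BY CONSTRUCTION and count-neutral, and it is NOT the world of record (N09's count line lives at def-T's `IsRecordOfRecord₁₂C`).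
[cite: Balaban1989LargeFieldII, Thm 1 + (0.1) pp.355–356 (bookkeeping)] -/
theorem sixSlot_of_isRecordOfRecord₁₂CB10YZWB8B12Prov (hR : IsRecordOfRecord₁₂CB10YZWB8B12Prov F N D w) :
    ∃ (θ : Stage12Params F N) (h : θ.Provisos₁₂ F N) (lam12 : ResidB12 F N θ.τ9.M) (lam : ResidB8 θ.toStage3Params) (Mstar : ℕ) (ops : OpsY N θ.toStage3Params Mstar)
      (ζ : ResidZ F N) (lamW : ResidW F N),
      θ.Admissible F N ∧ D = datumOfRecord₁₂ F N θ h ∧ w.C = D.C ∧ (0 < w.γ ∧ w.γ ≤ θ.γ) ∧ w.L = (θ.L : ℝ) ∧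
        ∀ P : B12.RunParams, w.up P = upOfRecord₅CS F N (θ.view₁₂B12B8B10YZW F N lam12 lam Mstar ops ζ lamW) P := by
  obtain ⟨θ, h, lam12, lam, Mstar, ops, ζ, lamW, hθ, hD, hC, hγ, hL, hup, -⟩ := hR
  exact ⟨θ, h, lam12, lam, Mstar, ops, ζ, lamW, hθ, hD, hC, hγ, hL, hup⟩

/-- **THE OWN LEAF OF N09's CONJUNCT 1 AT SUCH A RECORD**, with the provisos of the presenting layer. STATUS (ref-C NOTE-2 (c)(iii)): a PROVISO-CARRYING SUCCESSOR record — every closer over it is GAP-STATED(package) BY CONSTRUCTION and count-neutral, and it is NOT the world of record (N09's count line lives at def-T's `IsRecordOfRecord₁₂C`). [cite: Balaban1987RG1, Lemma 4 (3.53) p.280 (the leaf at the objects of record)] -/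
theorem leaf_b12_iff_of_isRecordOfRecord₁₂CB10YZWB8B12Prov (hR : IsRecordOfRecord₁₂CB10YZWB8B12Prov F N D w) :
    ∃ (θ : Stage12Params F N) (lam12 : ResidB12 F N θ.τ9.M), θ.Admissible F N ∧ (∀ P : B12.RunParams, B12Provisos (θ.Rz P.K) θ.s2.cB (lam12 P)) ∧
      ∀ P : B12.RunParams, (leavesP w P).b12 ↔ B12LeafOfRecord₁₂ F N θ lam12 P := by
  obtain ⟨θ, -, lam12, lam, Mstar, ops, ζ, lamW, hθ, -, -, -, -, hup, hΛ⟩ := hR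
  refine ⟨θ, lam12, hθ, hΛ, fun P => ?_⟩
  show (w.up P).b12 ↔ _
  rw [hup P]
  exact (upOfRecord₅CS_view₁₂B12B8B10YZW_leaves F N θ lam12 lam Mstar ops ζ lamW P).1

/-- **N09's CONJUNCT 1 HOLDS AT EVERY RUN OF SUCH A RECORD** — because the record DISPLAYS the package at the presenting layer (GAP-STATED(package) by construction of the predicate;
NOT a discharge of N09). STATUS (ref-C NOTE-2 (c)(iii)): a PROVISO-CARRYING SUCCESSOR record — every closer over it is GAP-STATED(package) BY CONSTRUCTION and count-neutral, and it is NOT the world of record (N09's count line lives at def-T's `IsRecordOfRecord₁₂C`). [cite: Balaban1987RG1, Lemma 4 (3.53) p.280 (the node's conjunct 1, bookkeeping)] -/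
theorem b12_leaf_of_isRecordOfRecord₁₂CB10YZWB8B12Prov (hR : IsRecordOfRecord₁₂CB10YZWB8B12Prov F N D w) (P : B12.RunParams) : (leavesP w P).b12 := by
  obtain ⟨θ, -, lam12, lam, Mstar, ops, ζ, lamW, hθ, -, -, -, -, hup, hΛ⟩ := hR
  exact b12_leaf_of_up_view₁₂B12B8B10YZW_of_provisos F N θ hθ lam12 lam Mstar ops ζ lamW (hup P) (hΛ P)

/-- RE-BINDING a `₁₂C` record's world by the S-binding at the six-pin view of NAMED slots WHOSE [B12] LAYER SATISFIES ITS PROVISOS gives a record of this module with the SAME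
datum (g32's `…_rebind_of_isRecordOfRecord₁₂C` with the provisos as an input). STATUS (ref-C NOTE-2 (c)(iii)): a PROVISO-CARRYING SUCCESSOR record — every closer over it is GAP-STATED(package) BY CONSTRUCTION and count-neutral, and it is NOT the world of record (N09's count line lives at def-T's `IsRecordOfRecord₁₂C`). [cite: Balaban1989LargeFieldII, Thm 1 p.355 (bookkeeping)] -/
theorem isRecordOfRecord₁₂CB10YZWB8B12Prov_rebind_of_isRecordOfRecord₁₂C (h : IsRecordOfRecord₁₂C F N D w) :
    ∃ (θ : Stage12Params F N) (_ : θ.Provisos₁₂ F N), θ.Admissible F N ∧ (∀ P, w.up P = upOfRecord₅C F N (θ.toStage5₁₂ F N) P) ∧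
      ∀ (lam12 : ResidB12 F N θ.τ9.M) (lam : ResidB8 θ.toStage3Params) (Mstar : ℕ) (ops : OpsY N θ.toStage3Params Mstar) (ζ : ResidZ F N) (lamW : ResidW F N),
        (∀ P : B12.RunParams, B12Provisos (θ.Rz P.K) θ.s2.cB (lam12 P)) →
          IsRecordOfRecord₁₂CB10YZWB8B12Prov F N D { w with up := fun P => upOfRecord₅CS F N (θ.view₁₂B12B8B10YZW F N lam12 lam Mstar ops ζ lamW) P } := by
  obtain ⟨θ, hP, hθ, hD, hC, hγ, hL, hup⟩ := h
  exact ⟨θ, hP, hθ, hup, fun lam12 lam Mstar ops ζ lamW hΛ => ⟨θ, hP, lam12, lam, Mstar, ops, ζ, lamW, hθ, hD, hC, hγ, hL, fun _ => rfl, hΛ⟩⟩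

variable (F N)

/-- **The same over the six-pin view WITH [B8′]** ([B8] over the sub-index of record): g32's `IsRecordOfRecord₁₂CB10YZWB8subB12` clauses VERBATIM plus the [B12] layer's provisos.
Inhabited only GIVEN packages. STATUS (ref-C NOTE-2 (c)(iii)): a PROVISO-CARRYING SUCCESSOR record — every closer over it is GAP-STATED(package) BY CONSTRUCTION and count-neutral, and it is NOT the world of record (N09's count line lives at def-T's `IsRecordOfRecord₁₂C`). [cite: Balaban1987RG1, Lemma 4 (3.53) p.280; Balaban1985RegularSpaces, Lemma 1 – Thm 8 pp.79–101; Balaban1989LargeFieldII, Thm 1 + (0.1) pp.355–356 (objects of record)] -/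
def IsRecordOfRecord₁₂CB10YZWB8subB12Prov (D : FiniteEpsData F (SU N)) (w : WorldP) : Prop :=
  ∃ (θ : Stage12Params F N) (h : θ.Provisos₁₂ F N) (lam12 : ResidB12 F N θ.τ9.M) (lam : ResidB8 θ.toStage3Params) (Mstar : ℕ) (ops : OpsY N θ.toStage3Params Mstar)
    (ζ : ResidZ F N) (lamW : ResidW F N),
    θ.Admissible F N ∧ D = datumOfRecord₁₂ F N θ h ∧ w.C = D.C ∧ (0 < w.γ ∧ w.γ ≤ θ.γ) ∧ w.L = (θ.L : ℝ) ∧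
      (∀ P : B12.RunParams, w.up P = upOfRecord₅CS F N (θ.view₁₂B12B8subB10YZW F N lam12 lam Mstar ops ζ lamW) P) ∧
      ∀ P : B12.RunParams, B12Provisos (θ.Rz P.K) θ.s2.cB (lam12 P)

/-- Inhabitation GIVEN `Provisos₁₂`, admissibility and the provisos of the named layer. STATUS (ref-C NOTE-2 (c)(iii)): a PROVISO-CARRYING SUCCESSOR record — every closer over it is GAP-STATED(package) BY CONSTRUCTION and count-neutral, and it is NOT the world of record (N09's count line lives at def-T's `IsRecordOfRecord₁₂C`). [cite: Balaban1989LargeFieldII, Thm 1 + (0.1) pp.355–356 (bookkeeping)] -/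
theorem exists_world_isRecordOfRecord₁₂CB10YZWB8subB12Prov (θ : Stage12Params F N) (h : θ.Provisos₁₂ F N) (hθ : θ.Admissible F N) (lam12 : ResidB12 F N θ.τ9.M)
    (lam : ResidB8 θ.toStage3Params) (Mstar : ℕ) (ops : OpsY N θ.toStage3Params Mstar) (ζ : ResidZ F N) (lamW : ResidW F N)
    (hΛ : ∀ P : B12.RunParams, B12Provisos (θ.Rz P.K) θ.s2.cB (lam12 P)) {γw : ℝ} (hγw : 0 < γw ∧ γw ≤ θ.γ) :
    ∃ w : WorldP, IsRecordOfRecord₁₂CB10YZWB8subB12Prov F N (datumOfRecord₁₂ F N θ h) w ∧ w.γ = γw := by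
  obtain ⟨w₀, -, -⟩ := exists_world_isRecordOfRecord₁₂C F N θ h hθ hγw
  exact ⟨{ w₀ with
      C := (datumOfRecord₁₂ F N θ h).C, γ := γw, L := (θ.L : ℝ), one_lt_L := by exact_mod_cast θ.hL.2,
      up := fun P => upOfRecord₅CS F N (θ.view₁₂B12B8subB10YZW F N lam12 lam Mstar ops ζ lamW) P },
    ⟨θ, h, lam12, lam, Mstar, ops, ζ, lamW, hθ, rfl, rfl, hγw, rfl, fun _ => rfl, hΛ⟩, rfl⟩

variable {F N}

/-- Forgetting the provisos: the six-slot presentation of g32's `IsRecordOfRecord₁₂CB10YZWB8subB12` (its clauses verbatim), SAME datum, SAME world. STATUS (ref-C NOTE-2 (c)(iii)): a PROVISO-CARRYING SUCCESSOR record — every closer over it is GAP-STATED(package) BY CONSTRUCTION and count-neutral, and it is NOT the world of record (N09's count line lives at def-T's `IsRecordOfRecord₁₂C`).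
[cite: Balaban1989LargeFieldII, Thm 1 + (0.1) pp.355–356 (bookkeeping)] -/
theorem sixSlot_of_isRecordOfRecord₁₂CB10YZWB8subB12Prov (hR : IsRecordOfRecord₁₂CB10YZWB8subB12Prov F N D w) :
    ∃ (θ : Stage12Params F N) (h : θ.Provisos₁₂ F N) (lam12 : ResidB12 F N θ.τ9.M) (lam : ResidB8 θ.toStage3Params) (Mstar : ℕ) (ops : OpsY N θ.toStage3Params Mstar)
      (ζ : ResidZ F N) (lamW : ResidW F N),
      θ.Admissible F N ∧ D = datumOfRecord₁₂ F N θ h ∧ w.C = D.C ∧ (0 < w.γ ∧ w.γ ≤ θ.γ) ∧ w.L = (θ.L : ℝ) ∧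
        ∀ P : B12.RunParams, w.up P = upOfRecord₅CS F N (θ.view₁₂B12B8subB10YZW F N lam12 lam Mstar ops ζ lamW) P := by
  obtain ⟨θ, h, lam12, lam, Mstar, ops, ζ, lamW, hθ, hD, hC, hγ, hL, hup, -⟩ := hR
  exact ⟨θ, h, lam12, lam, Mstar, ops, ζ, lamW, hθ, hD, hC, hγ, hL, hup⟩

/-- The own leaf of N09's conjunct 1 at such a record, with the provisos of the presenting layer. STATUS (ref-C NOTE-2 (c)(iii)): a PROVISO-CARRYING SUCCESSOR record — every closer over it is GAP-STATED(package) BY CONSTRUCTION and count-neutral, and it is NOT the world of record (N09's count line lives at def-T's `IsRecordOfRecord₁₂C`). [cite: Balaban1987RG1, Lemma 4 (3.53) p.280 (the leaf at the objects of record)] -/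
theorem leaf_b12_iff_of_isRecordOfRecord₁₂CB10YZWB8subB12Prov (hR : IsRecordOfRecord₁₂CB10YZWB8subB12Prov F N D w) :
    ∃ (θ : Stage12Params F N) (lam12 : ResidB12 F N θ.τ9.M), θ.Admissible F N ∧ (∀ P : B12.RunParams, B12Provisos (θ.Rz P.K) θ.s2.cB (lam12 P)) ∧
      ∀ P : B12.RunParams, (leavesP w P).b12 ↔ B12LeafOfRecord₁₂ F N θ lam12 P := by
  obtain ⟨θ, -, lam12, lam, Mstar, ops, ζ, lamW, hθ, -, -, -, -, hup, hΛ⟩ := hR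
  refine ⟨θ, lam12, hθ, hΛ, fun P => ?_⟩
  show (w.up P).b12 ↔ _
  rw [hup P]
  exact (upOfRecord₅CS_view₁₂B12B8subB10YZW_leaves F N θ lam12 lam Mstar ops ζ lamW P).1

/-- N09's conjunct 1 holds at every run of such a record (GAP-STATED(package) by construction; NOT a discharge). STATUS (ref-C NOTE-2 (c)(iii)): a PROVISO-CARRYING SUCCESSOR record — every closer over it is GAP-STATED(package) BY CONSTRUCTION and count-neutral, and it is NOT the world of record (N09's count line lives at def-T's `IsRecordOfRecord₁₂C`). [cite: Balaban1987RG1, Lemma 4 (3.53) p.280 (the node's conjunct 1, bookkeeping)] -/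
theorem b12_leaf_of_isRecordOfRecord₁₂CB10YZWB8subB12Prov (hR : IsRecordOfRecord₁₂CB10YZWB8subB12Prov F N D w) (P : B12.RunParams) : (leavesP w P).b12 := by
  obtain ⟨θ, -, lam12, lam, Mstar, ops, ζ, lamW, hθ, -, -, -, -, hup, hΛ⟩ := hR
  exact b12_leaf_of_up_view₁₂B12B8subB10YZW_of_provisos F N θ hθ lam12 lam Mstar ops ζ lamW (hup P) (hΛ P)

/-- RE-BINDING a `₁₂C` record's world by the S-binding at the six-pin view with [B8′] of named slots whose [B12] layer satisfies its provisos gives a record of this module with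
the SAME datum. STATUS (ref-C NOTE-2 (c)(iii)): a PROVISO-CARRYING SUCCESSOR record — every closer over it is GAP-STATED(package) BY CONSTRUCTION and count-neutral, and it is NOT the world of record (N09's count line lives at def-T's `IsRecordOfRecord₁₂C`). [cite: Balaban1989LargeFieldII, Thm 1 p.355 (bookkeeping)] -/
theorem isRecordOfRecord₁₂CB10YZWB8subB12Prov_rebind_of_isRecordOfRecord₁₂C (h : IsRecordOfRecord₁₂C F N D w) :
    ∃ (θ : Stage12Params F N) (_ : θ.Provisos₁₂ F N), θ.Admissible F N ∧ (∀ P, w.up P = upOfRecord₅C F N (θ.toStage5₁₂ F N) P) ∧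
      ∀ (lam12 : ResidB12 F N θ.τ9.M) (lam : ResidB8 θ.toStage3Params) (Mstar : ℕ) (ops : OpsY N θ.toStage3Params Mstar) (ζ : ResidZ F N) (lamW : ResidW F N),
        (∀ P : B12.RunParams, B12Provisos (θ.Rz P.K) θ.s2.cB (lam12 P)) →
          IsRecordOfRecord₁₂CB10YZWB8subB12Prov F N D { w with up := fun P => upOfRecord₅CS F N (θ.view₁₂B12B8subB10YZW F N lam12 lam Mstar ops ζ lamW) P } := by
  obtain ⟨θ, hP, hθ, hD, hC, hγ, hL, hup⟩ := h
  exact ⟨θ, hP, hθ, hup, fun lam12 lam Mstar ops ζ lamW hΛ => ⟨θ, hP, lam12, lam, Mstar, ops, ζ, lamW, hθ, hD, hC, hγ, hL, fun _ => rfl, hΛ⟩⟩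

end ProvisoRecords

/-! ## §4. The erratum's kernel negatives: the named zero layer (READ #117), why no ∀-over-layers package binder is typed at Stage 12, why the Stage-11 closer is vacuous, and the junk horn of (B4) by name (DISPLAY ONLY — consumed by no face above) -/

section Negatives

variable {P : Params} {N M : ℕ}

/-- **THE ZERO LAYER OF READ #117, BY NAME**: a residual layer with `B₃ := 0` and `α₀ := 0` (all other letters kept) — ref-C's `lam0 := lam12[B₃ := 0, α₀ := 0]`
(`probe-p457025-hL.lean`).  It carries NO package (`isEmpty_package_zeroLayer`: the field `hB : 1 ≤ B₃` reads `1 ≤ 0`) and yet has a TRUE leaf (`b12LeafOfRecord_zeroLayer`: its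
constants violate the restriction `0 < α₀`, so `Lemma4Printed` holds vacuously). [cite: Balaban1987RG1, (3.37) p.277, Lemma 4 (3.53) p.280 (bookkeeping: the typed letters, not print)] -/
def ResidB12Run.zeroLayer (lam : ResidB12Run P N M) : ResidB12Run P N M :=
  { lam with B₃ := 0, α₀ := 0 }

/-- [cite: Balaban1987RG1, (3.37) p.277 (bookkeeping)] -/
theorem ResidB12Run.zeroLayer_B₃ (lam : ResidB12Run P N M) : lam.zeroLayer.B₃ = 0 := rfl

/-- [cite: Balaban1987RG1, Lemma 4 p.280 (bookkeeping)] -/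
theorem ResidB12Run.zeroLayer_α₀ (lam : ResidB12Run P N M) : lam.zeroLayer.α₀ = 0 := rfl

/-- **THE ZERO LAYER CARRIES NO PACKAGE** (`hB : 1 ≤ B₃` at `B₃ = 0`). [cite: Balaban1987RG1, (3.37) p.277 (bookkeeping: the typed restriction `1 ≤ B₃`, not print)] -/
theorem isEmpty_package_zeroLayer (Rz : Sect2.Residual P (MatA N)) (cB : ℝ) (lam : ResidB12Run P N M) : IsEmpty (B12Package Rz cB lam.zeroLayer) :=
  ⟨fun L => by
    have h1 : (1 : ℝ) ≤ 0 := L.hB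
    norm_num at h1⟩

/-- **… AND YET ITS LEAF IS TRUE** — through the junk horn (`0 < α₀` fails at `α₀ = 0`): the kernel form of «a true leaf displays nothing without the restrictions» (ref-C READ116 (B4),
READ #117 `leaf_zero_layer`). DISPLAY ONLY. [cite: Balaban1987RG1, Lemma 4 (3.53) p.280 (bookkeeping: the typed leaf)] -/
theorem b12LeafOfRecord_zeroLayer [NeZero N] (Rz : Sect2.Residual P (MatA N)) (cB : ℝ) (lam : ResidB12Run P N M) : B12LeafOfRecord Rz cB lam.zeroLayer :=
  fun hR => absurd hR.1 (lt_irrefl _)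

/-- **THE JUNK HORN OF (B4), BY NAME**: a layer whose constants VIOLATE the restrictions has a TRUE leaf — vacuously (`Lemma4Printed` is `Lemma4Restrictions c → …`).  Why a count line
must display `restrictions` (and why the bare six-pin record predicates book nothing through `b12`).  DISPLAY ONLY: no face of §0–§3 consumes it (ref-C NOTE-2 (c)(iv)).
[cite: Balaban1987RG1, Lemma 4 (3.53) p.280 (bookkeeping: the typed leaf)] -/
theorem b12LeafOfRecord_of_not_restrictions [NeZero N] {Rz : Sect2.Residual P (MatA N)} {cB : ℝ} {lam : ResidB12Run P N M}
    (h : ¬ B12Sec2to5.Lemma4Restrictions lam.consts) : B12LeafOfRecord Rz cB lam :=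
  fun hR => absurd hR h

/-- **THE PACKAGE IS NOT A LAW OF THE BARE RESIDUAL TYPE** (ref-C READ117 card (B9), kernel form): no `(Rz, cB)` has a package at EVERY layer — witness the zero layer of any inhabitant
(g32's `nonempty_residB12Run`). [cite: Balaban1987RG1, (3.37) p.277 (bookkeeping: the typed restriction `1 ≤ B₃`, not print)] -/
theorem not_forall_nonempty_package (Rz : Sect2.Residual P (MatA N)) (cB : ℝ) :
    ¬ ∀ lam : ResidB12Run P N M, Nonempty (B12Package Rz cB lam) := fun h =>
  (nonempty_residB12Run (P := P) (N := N) (M := M)).elim fun lam => (h lam.zeroLayer).elim fun L => (isEmpty_package_zeroLayer Rz cB lam).false L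

variable (F : T4Family) (N : ℕ) [NeZero N]

/-- **… hence at NO Stage-12 parameter does every residual [B12] layer carry a package at every run** (the zero layer of an inhabitant of g32's `ResidB12`, at the run `⟨0, 0, 0⟩`).
[cite: Balaban1987RG1, (3.37) p.277 (bookkeeping: the typed restriction `1 ≤ B₃`, not print)] -/
theorem not_forall_resid_package₁₂ (θ : Stage12Params F N) :
    ¬ ∀ (lam12 : ResidB12 F N θ.τ9.M) (P : B12.RunParams), Nonempty (B12Package (θ.Rz P.K) θ.s2.cB (lam12 P)) := fun h =>
  (nonempty_residB12 (F := F) (N := N) θ.τ9.M).elim fun lam12 =>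
    (h (fun P => (lam12 P).zeroLayer) ⟨0, 0, 0⟩).elim fun L => (isEmpty_package_zeroLayer (θ.Rz (0 : ℕ)) θ.s2.cB (lam12 ⟨0, 0, 0⟩)).false L

variable {F N}
variable {D : FiniteEpsData F (SU N)} {w : WorldP}

/-- **THE COMPANION'S BINDER TYPE IS EMPTY AT EVERY STAGE-12 RECORD** (ref-C's `hL_false_of_record` ∕ card (B9′) ported to def-T's `Record12`): a `₁₂C` record presents SOME `(θ, hP)`
with `θ.Admissible` and `D = datumOfRecord₁₂ θ hP`, at which an ∀-over-layers package binder would yield a package at the zero layer.  Every carrier-pinned Stage-12 record predicate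
(g32's `Record12CarriersRecords` ∕ `Record12CarriersB12`, §3 above) presents such a pair too — so NO `…_of_package` face with this binder is typed at Stage 12 (it would conclude
from an empty type). [cite: Balaban1989LargeFieldII, Thm 1 + (0.1) pp.355–356 (bookkeeping: the typed record, not print)] -/
theorem isEmpty_forallPackageBinder₁₂_of_isRecordOfRecord₁₂C (h : IsRecordOfRecord₁₂C F N D w) :
    IsEmpty (∀ (θ : Stage12Params F N) (hP : θ.Provisos₁₂ F N) (lam12 : ResidB12 F N θ.τ9.M), θ.Admissible F N → D = datumOfRecord₁₂ F N θ hP →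
      ∀ P : B12.RunParams, B12Package (θ.Rz P.K) θ.s2.cB (lam12 P)) := by
  obtain ⟨θ, hP, hθ, hD, -⟩ := h
  exact ⟨fun hL => not_forall_resid_package₁₂ F N θ fun lam12 P => ⟨hL θ hP lam12 hθ hD P⟩⟩

variable (F N) in
/-- **ERRATUM, FIRST HALF — THE STAGE-11 CLOSER'S PREMISE TYPE IS EMPTY**: g32's `IsRecordOfRecord₁₁CB10YZWB8B12` presents a `θ.Provisos₁₁`, which def-T's `not_provisos₁₁` refutes;
so the companion's `b12_leaf_of_isRecordOfRecord₁₁CB10YZWB8B12_of_package` (p456282 :219–:226) concludes from `False` (and so does every consumer, e.g. dag-n09-c's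
`b12_leaf_of_isRecordOfRecord₁₁CB10YZWB8B12_of_fundamental`, ref-G ADDENDUM-ROW24). [cite: Balaban1988Convergent, (2.28) p.259 (bookkeeping: the typed hypothesis, not print)] -/
theorem not_isRecordOfRecord₁₁CB10YZWB8B12 (D : FiniteEpsData F (SU N)) (w : WorldP) : ¬ IsRecordOfRecord₁₁CB10YZWB8B12 F N D w :=
  fun ⟨θ, h, _⟩ => not_provisos₁₁ F N θ h

/-- **ERRATUM, SECOND HALF — THE STAGE-11 CLOSER'S BINDER TYPE IS INHABITED OUTRIGHT** (a free Π over the EMPTY proviso type; dag-ref-G ADDENDUM-ROW13 `refG_hL_trivial`, ref-C card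
(B9′)): at Stage 11 the binder displays nothing; at Stage 12 the same shape is EMPTY (`isEmpty_forallPackageBinder₁₂_of_isRecordOfRecord₁₂C`).
[cite: Balaban1988Convergent, (2.28) p.259 (bookkeeping: the typed hypothesis, not print)] -/
theorem nonempty_forallPackageBinder₁₁ (D : FiniteEpsData F (SU N)) :
    Nonempty (∀ (θ : Stage11Params F N) (hP : θ.Provisos₁₁ F N) (lam12 : ResidB12 F N θ.τ9.M), θ.Admissible → D = datumOfRecord₁₁ F N θ hP →
      ∀ P : B12.RunParams, B12Package (θ.Rz P.K) θ.s2.cB (lam12 P)) :=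
  ⟨fun θ hP => absurd hP (not_provisos₁₁ F N θ)⟩

end Negatives

end Literature.MathematicalPhysics.QuantumFieldTheory.Balaban1983to89.Node00

end
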